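import Summits.BirchSwinnertonDyer.BirchSwinnertonDyer.Theorems.SignedLowerHalvesSmallImageLowerHalfBothSignsLambdaLowerThreeNsAFEClosure
import Summits.BirchSwinnertonDyer.BirchSwinnertonDyer.Theorems.SignedLowerHalvesSmallImageLowerHalfBothSignsLambdaLowerThreeNsParity
import HarnessLib

/-!
# Route `SignedLowerHalves` (K3), child crux L `SmallImageLowerHalfBothSigns` (item stmt-BirchSwinnertonDyer-23599),
# line `birth_acns`, stub `stub_lambdaLowerThree_ns` (= retired item 23118 `SmallImageLambdaLowerAtThree`, VERBATIM):
# the stub BY NAME ⟸ loci ∧ Kobayashi Thm. 1.2 / 4.1 ∧ B. D. Kim 2013 Cor. 3.15 ∧ `p`-parity at `3` ∧ the ALGEBRAIC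
# FUNCTIONAL EQUATION at `3` on the class ∧ the `T = 0` SHADOW inputs on the rank-`0` `λ = 2` stratum ∧ the rest
# (cell `bsd-ssimc`, width seat `bsd-line-slh-p3-w3` gen 4; by-name helper `--supports 23599`)

HONEST FRAMING: CALIBRATION / SUPPORT ONLY. The stub is OPEN MATHEMATICS (w3 g0 `stub-blocked`); nothing here closes it;
BSD / child L / the stub are NOT proved. Conditional on DISPLAYED binders: published named facts (`h12`, `h41`, `hK13`,
`hCK`, `h5`, `h3`, `p_parity · 3`), the tree's two unrefereed binders (`FouquetWan2021_thm51_via_kobayashi74_OPEN`,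
`BurungaleSkinnerTianWan2024_thm13_twist_OPEN`), the algebraic functional equation of `Sel^ε(E/ℚ_∞)` at `p = 3` on the
small-image X7 class (`hAFE3` — B. D. Kim 2008 Thm. 3.12 with its printed `p > 3` deleted: the tree's TYPING REQUEST,
not a theorem of the tree and NOT asserted here), and the residue of the stub itself. THEOREMS ONLY; no definition, no
named fact, no `sorry`.

## What is proved

`smallImageLambdaLowerAtThree_of_loci_of_afe_of_shadow_of_residue` — the stub BY NAME from: `hFW`, `hBSTW`, `h12`,
`h41`, `hK13`, `hCK`, `h5`, `h3`, `hpar3 : ∀ E/ℚ, p_parity E 3`, `hAFE3`, and THREE residue clauses at the `p = 3`, X7,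
¬CM, `a_3 = 0`, ¬Surj pairs OFF both loci (w3 g3's paired-excess residue `corank Sel_{3^∞}(E/ℚ) + 2 ≤ λ(L_3^ε)`), split
by this gen's route-independent files `…LambdaLowerThreeNsAFE.lean` / `…LambdaLowerThreeNsAFEClosure.lean`:
* `hshadow` — rank `0` (`Sel_{3^∞}(E/ℚ)` finite) with CERTIFICATE `(μ, λ)(L_3^ε) = (0, 2)`: ONLY the `T = 0` SHADOW
  «`3 ∣ Tam(E)·#Sel_{3^∞}(E/ℚ)`» (NECESSARY for the stub there, `dvd_tamagawa_mul_card_selmer_of_lam_pos_of_lamLe`;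
  decidable per pair) — NO Iwasawa-theoretic statement is asked on this stratum: the analytic `μ = 0` gives the
  algebraic `μ(X^ε) = 0` through crux M's brick, and the functional equation gives `λ(ξ^ε) ≥ 2`;
* `hres0` — rank `0`, certificate NOT `(0, 2)` (so `λ(L_3^ε) ≥ 4`, or `λ = 2` with `μ(L_3^ε) > 0`): the door widened on
  the algebraic side, «`λ(L_3^ε) ≤ λ(ξ^ε) + 1`»;
* `hres1` — positive corank (`Sel_{3^∞}(E/ℚ)` infinite): the plain λ-inequality (no functional-equation gain there: the
  involution controls `ord_T ξ^ε`, not the corank, absent semisimplicity at `T = 0`).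
READING (numbers, not adjectives; W-plan-12 v5 window: 100 small-image `p = 3` X7 pairs, 96 of rank `0`, 4 of rank `1`):
modulo AFE(3) and print, the rank-`0` `(0, 2)`-certified sub-stratum of `stub_lambdaLowerThree_ns` IS the `3`-part-of-BSD
lower bound at `T = 0` («`3 ∣ L(E,1)/Ω_E ⟹ 3 ∣ Tam·#Ш[3^∞]`», `E(ℚ)[3] = 0` here); the engine territory (w3 g3) starts at
`λ(L_3^ε) ≥ λ(ξ^ε) + 2` in rank `0` and at corank `≥ 1`.

References: [KimBD2008MRL] Thm. 3.12 (p. 93), §1 p. 83; [Kobayashi2003] Thm. 1.2, Thm. 4.1 (p. 8), Conjecture (p. 2);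
[BDKim2013] Cor. 3.15 (p. 199); [DokchitserDokchitserAnnals2010] Thm. 1.4, Cor. 4.20; [Sprung2017] Cor. 4.14;
[FouquetWan2021] Thm. 5.1 (PRE); [BurungaleSkinnerTianWan2024] Thm. 1.3 (PRE); [GreenbergLNM1716] Thm. 1.14, Prop. 3.10.
-/

set_option autoImplicit false
-- D-0017: single-problem summit, the namespace repeats the problem name by design.
set_option linter.dupNamespace false

noncomputable section

open scoped Classical MatrixGroups ModularForm

open CongruenceSubgroup PowerSeries WeierstrassCurve Field Literature.NumberTheory.EllipticCurves
  Literature.NumberTheory.EllipticCurves.ModularForms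
  Literature.NumberTheory.EllipticCurves.Rank1Residual
  Literature.NumberTheory.EllipticCurves.Kobayashi2003 ZpExtension
  Literature.NumberTheory.EllipticCurves.Rank1Residual.Typed
  Summit.BirchSwinnertonDyer.Rank1Residual
  Summit.BirchSwinnertonDyer.Rank1Residual.X1.MuLambda
  Summit.BirchSwinnertonDyer.Rank1Residual.Supersingular

namespace Summit.BirchSwinnertonDyer.BirchSwinnertonDyer.Theorems.SmallImageLambdaLowerThreeNsAFEResidue

open SmallImageLambdaLowerThreeNsDoor SmallImageLambdaLowerThreeNs SmallImageLambdaParityMuFree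
  SmallImageLambdaLowerThreeNsParity SmallImageLambdaLowerThreeNsAFE SmallImageLambdaLowerThreeNsAFEClosure

/-- **The stub BY NAME from the loci, Kobayashi Thm. 1.2 / 4.1 / 6.2–7.3, B. D. Kim 2013 Cor. 3.15, the period units,
`p`-parity at `3`, the algebraic functional equation at `3` on the class, the `T = 0` shadow on the rank-`0`
`(0, 2)`-certified stratum, and the rest of the paired-excess residue.** Hypotheses BY NAME: `hFW`, `hBSTW` (the tree's two
unrefereed binders), `h12`, `h41` (rational display), `hCK`, `hK13`, `h5`, `h3`, `hpar3` (Dokchitser–Dokchitser at `p = 3`),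
`hAFE3` (`ι(Char X^ε) = Char X^ε` for every dual datum at every `p = 3`, X7, ¬CM, `a_3 = 0`, ¬Surj pair — Kim 2008 Thm. 3.12
with `p > 3` deleted: a HYPOTHESIS), and, at the pairs OFF both loci (every frame, the newform, every Pollack pair):
`hshadow` (rank `0`, `(μ, λ)(L_3^ε) = (0, 2)`: `3 ∣ ∏ c_ℓ · #Sel_{3^∞}(E/ℚ)` — nothing else), `hres0` (rank `0`, certificate
not `(0, 2)`, `corank + 2 ≤ λ`: `λ(L_3^ε) ≤ λ(ξ^ε) + 1`), `hres1` (`Sel_{3^∞}(E/ℚ)` infinite, `corank + 2 ≤ λ`: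
`λ(L_3^ε) ≤ λ(ξ^ε)`). Proof: w3 g3's `smallImageLambdaLowerAtThree_of_loci_of_pairedExcessZeroResidue`, its residue fed per
pair and sign by `lam_kobayashiL_le_lam_charGen_of_cert_of_not_surj` (shadow stratum),
`lam_kobayashiL_le_lam_charGen_of_afe_of_le_add_one` (rank `0` otherwise) or `hres1`. CALIBRATION ONLY.
[claim: FouquetWan2021, status: under-review] [claim: BurungaleSkinnerTianWan2024, status: under-review]
[cite: Kobayashi2003, Thm. 1.2, Thm. 4.1 (p. 8), Thm. 6.2–6.3, Thm. 7.3 (7.21), Conjecture (p. 2)]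
[cite: KimBD2008MRL, Thm. 3.12 (p. 93) and §1 p. 83] [cite: BDKim2013, Cor. 3.15 (p. 199)]
[cite: DokchitserDokchitserAnnals2010, Thm. 1.4 and Cor. 4.20] [cite: Sprung2017, Cor. 4.14 (a_p = 0 display)] -/
theorem smallImageLambdaLowerAtThree_of_loci_of_afe_of_shadow_of_residue
    (hFW : FouquetWan2021_thm51_via_kobayashi74_OPEN)
    (hBSTW : BurungaleSkinnerTianWan2024_thm13_twist_OPEN)
    (h12 : Kobayashi2003.thm12_signedSelmerDual_finite_torsion)
    (h41 : Kobayashi2003.thm41_signedCharIdeal_divisibility)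
    (hCK : Kobayashi2003.thm62_63_73_signedColemanKato_zeta)
    (hK13 : BDKim2013.cor315_signedCharValue_rankZero)
    (h5 : realPeriodRat_eq_unit_mul_plusPeriod) (h3 : realPeriodRat_eq_unit_mul_plusPeriod_three)
    (hpar3 : ∀ (W : WeierstrassCurve ℚ) [W.IsElliptic], p_parity W 3)
    (hAFE3 : ∀ (W : WeierstrassCurve ℚ) [W.IsElliptic] [W.IsGloballyMinimal] (p : ℕ) [Fact p.Prime],
      p = 3 → ClassX7 W p → ¬ W.HasCM → W.frobeniusTrace p = 0 → ¬ Surj W p →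
      ∀ (κ : ZpExtension ℚ p) (γ : absoluteGaloisGroup ℚ), κ.IsCyclotomic → κ.IsTopGenerator γ →
      ∀ (ε : ℤˣ) (D : SignedSelmerDualData W κ γ ε),
        Ideal.map (IwasawaAlgebra.invol p) D.charIdeal = D.charIdeal)
    (hshadow : ∀ (W : WeierstrassCurve ℚ) [W.IsElliptic] [W.IsGloballyMinimal] (p : ℕ) [Fact p.Prime],
      p = 3 → ClassX7 W p → ¬ W.HasCM → W.frobeniusTrace p = 0 → ¬ Surj W p →
      (¬ ∃ (ℓ : ℕ) (_ : Fact ℓ.Prime), ℓ ≠ p ∧ W.HasMultiplicativeReductionAtPrime ℓ ∧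
          ¬ W.HasSplitMultiplicativeReductionAtPrime ℓ ∧ ¬ p ∣ padicValInt ℓ W.minimalDiscriminantInt) →
      (¬ ∃ (W₀ : WeierstrassCurve ℚ) (_ : W₀.IsElliptic) (_ : W₀.IsGloballyMinimal)
          (K : Type) (_ : Field K) (_ : NumberField K),
          Semistable W₀ ∧ GoodSS W₀ p ∧ (p = 3 → W₀.frobeniusTrace 3 = 0) ∧ Module.finrank ℚ K = 2 ∧
          IsCoprime (NumberField.discr K) ((W₀.conductorNorm ℤ * p : ℕ) : ℤ) ∧
          (∀ (ℓ : ℕ) [Fact ℓ.Prime], (ℓ : ℤ) ∣ NumberField.discr K → GoodOrd W₀ ℓ) ∧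
          ∃ C : VariableChange ℚ, C • W₀.quadraticTwist (NumberField.discr K : ℚ) = W) →
      ∀ (ε : ℤˣ) (κ : ZpExtension ℚ p) (γ : absoluteGaloisGroup ℚ),
          κ.IsCyclotomic → κ.IsTopGenerator γ → IsCyclotomicVariable p γ →
        ∀ [NeZero (W.conductorNorm ℤ)] (f : CuspForm (Gamma0 (W.conductorNorm ℤ)) 2), IsNewformOf W f →
        ∀ (Lplus Lminus : IwasawaAlgebra p), IsPollackPair f p Lplus Lminus →
          Finite (W.selmerGroupPInfty p) →
          mu (kobayashiL ε Lplus Lminus) = 0 → lam (kobayashiL ε Lplus Lminus) = 2 →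
        p ∣ W.tamagawaProduct * Nat.card (W.selmerGroupPInfty p))
    (hres0 : ∀ (W : WeierstrassCurve ℚ) [W.IsElliptic] [W.IsGloballyMinimal] (p : ℕ) [Fact p.Prime],
      p = 3 → ClassX7 W p → ¬ W.HasCM → W.frobeniusTrace p = 0 → ¬ Surj W p →
      (¬ ∃ (ℓ : ℕ) (_ : Fact ℓ.Prime), ℓ ≠ p ∧ W.HasMultiplicativeReductionAtPrime ℓ ∧
          ¬ W.HasSplitMultiplicativeReductionAtPrime ℓ ∧ ¬ p ∣ padicValInt ℓ W.minimalDiscriminantInt) →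
      (¬ ∃ (W₀ : WeierstrassCurve ℚ) (_ : W₀.IsElliptic) (_ : W₀.IsGloballyMinimal)
          (K : Type) (_ : Field K) (_ : NumberField K),
          Semistable W₀ ∧ GoodSS W₀ p ∧ (p = 3 → W₀.frobeniusTrace 3 = 0) ∧ Module.finrank ℚ K = 2 ∧
          IsCoprime (NumberField.discr K) ((W₀.conductorNorm ℤ * p : ℕ) : ℤ) ∧
          (∀ (ℓ : ℕ) [Fact ℓ.Prime], (ℓ : ℤ) ∣ NumberField.discr K → GoodOrd W₀ ℓ) ∧
          ∃ C : VariableChange ℚ, C • W₀.quadraticTwist (NumberField.discr K : ℚ) = W) →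
      ∀ (ε : ℤˣ) (κ : ZpExtension ℚ p) (γ : absoluteGaloisGroup ℚ),
          κ.IsCyclotomic → κ.IsTopGenerator γ → IsCyclotomicVariable p γ →
        ∀ [NeZero (W.conductorNorm ℤ)] (f : CuspForm (Gamma0 (W.conductorNorm ℤ)) 2), IsNewformOf W f →
        ∀ (Lplus Lminus : IwasawaAlgebra p), IsPollackPair f p Lplus Lminus →
          Finite (W.selmerGroupPInfty p) →
          ¬ (mu (kobayashiL ε Lplus Lminus) = 0 ∧ lam (kobayashiL ε Lplus Lminus) = 2) →
          W.selmerCorank p + 2 ≤ lam (kobayashiL ε Lplus Lminus) →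
        ∀ (D : SignedSelmerDualData W κ γ ε) (ξ : IwasawaAlgebra p), D.charIdeal = Ideal.span {ξ} →
          lam (kobayashiL ε Lplus Lminus) ≤ lam ξ + 1)
    (hres1 : ∀ (W : WeierstrassCurve ℚ) [W.IsElliptic] [W.IsGloballyMinimal] (p : ℕ) [Fact p.Prime],
      p = 3 → ClassX7 W p → ¬ W.HasCM → W.frobeniusTrace p = 0 → ¬ Surj W p →
      (¬ ∃ (ℓ : ℕ) (_ : Fact ℓ.Prime), ℓ ≠ p ∧ W.HasMultiplicativeReductionAtPrime ℓ ∧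
          ¬ W.HasSplitMultiplicativeReductionAtPrime ℓ ∧ ¬ p ∣ padicValInt ℓ W.minimalDiscriminantInt) →
      (¬ ∃ (W₀ : WeierstrassCurve ℚ) (_ : W₀.IsElliptic) (_ : W₀.IsGloballyMinimal)
          (K : Type) (_ : Field K) (_ : NumberField K),
          Semistable W₀ ∧ GoodSS W₀ p ∧ (p = 3 → W₀.frobeniusTrace 3 = 0) ∧ Module.finrank ℚ K = 2 ∧
          IsCoprime (NumberField.discr K) ((W₀.conductorNorm ℤ * p : ℕ) : ℤ) ∧
          (∀ (ℓ : ℕ) [Fact ℓ.Prime], (ℓ : ℤ) ∣ NumberField.discr K → GoodOrd W₀ ℓ) ∧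
          ∃ C : VariableChange ℚ, C • W₀.quadraticTwist (NumberField.discr K : ℚ) = W) →
      ∀ (ε : ℤˣ) (κ : ZpExtension ℚ p) (γ : absoluteGaloisGroup ℚ),
          κ.IsCyclotomic → κ.IsTopGenerator γ → IsCyclotomicVariable p γ →
        ∀ [NeZero (W.conductorNorm ℤ)] (f : CuspForm (Gamma0 (W.conductorNorm ℤ)) 2), IsNewformOf W f →
        ∀ (Lplus Lminus : IwasawaAlgebra p), IsPollackPair f p Lplus Lminus →
          ¬ Finite (W.selmerGroupPInfty p) → W.selmerCorank p + 2 ≤ lam (kobayashiL ε Lplus Lminus) →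
        ∀ (D : SignedSelmerDualData W κ γ ε) (ξ : IwasawaAlgebra p), D.charIdeal = Ideal.span {ξ} →
          lam (kobayashiL ε Lplus Lminus) ≤ lam ξ) :
    Summit.BirchSwinnertonDyer.BirchSwinnertonDyer.Theses.SignedLowerHalves.SmallImageLambdaLowerAtThree := by
  refine smallImageLambdaLowerAtThree_of_loci_of_pairedExcessZeroResidue hFW hBSTW h12 h41 hpar3 ?_
  intro W _ _ p _ hp3 hX hCM hap hs hloc htw ε κ γ hκ hγ hγ' _ f hf Lplus Lminus hPP h2 D ξ hξ
  have hp : p ≠ 2 := by rw [hp3]; decide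
  by_cases hfin : Finite (W.selmerGroupPInfty p)
  · have hAFE : Ideal.map (IwasawaAlgebra.invol p) D.charIdeal = D.charIdeal :=
      hAFE3 W p hp3 hX hCM hap hs κ γ hκ hγ ε D
    by_cases hc : mu (kobayashiL ε Lplus Lminus) = 0 ∧ lam (kobayashiL ε Lplus Lminus) = 2
    · -- the `(0, 2)`-certified stratum: only the `T = 0` shadow is asked
      have hdvd := hshadow W p hp3 hX hCM hap hs hloc htw ε κ γ hκ hγ hγ' f hf Lplus Lminus hPP hfin hc.1 hc.2
      exact lam_kobayashiL_le_lam_charGen_of_cert_of_not_surj h12 hCK hK13 h5 h3 hp hX.1.1 hap hs hf hκ hγ hγ' hPP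
        hc.1 hc.2.le D hξ hAFE hfin hdvd
    · -- rank `0`, certificate not `(0, 2)`: the widened door
      have hparW : p_parity W p := by subst hp3; exact hpar3 W
      exact lam_kobayashiL_le_lam_charGen_of_afe_of_le_add_one h12 h41 hK13 hparW hp hX.1.1 hap hf hκ hγ hγ' hPP D
        hξ hAFE hfin (hres0 W p hp3 hX hCM hap hs hloc htw ε κ γ hκ hγ hγ' f hf Lplus Lminus hPP hfin hc h2 D ξ hξ)
  · exact hres1 W p hp3 hX hCM hap hs hloc htw ε κ γ hκ hγ hγ' f hf Lplus Lminus hPP hfin h2 D ξ hξ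

end Summit.BirchSwinnertonDyer.BirchSwinnertonDyer.Theorems.SmallImageLambdaLowerThreeNsAFEResidue

end
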